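import Literature.Probability.LatticeModels.BalabanStepOneFormatXYCalibration

/-!
# Balaban's step-one format — calibration, part 2a: bond geometry of the block torus

Bookkeeping for the depth-one representation of the XY Gibbs weight
(`BalabanStepOneFormatXYMembership`): bonds `b = (s, i)` of the block torus `Site L' M`, their
endpoint pairs `edge b = {s, s + eᵢ}` and complex gradients `grad z b`, and the action of the three
symmetries of the format on bonds — translations (`bondAdd`), the time reflection (`bondRefl`, base
point `reflBase`: the temporal bond is reversed) and the spatial inversion (`bondInv`, base point
`invBase`: the spatial bonds are reversed) — with the identities saying that the transformed bond has
the transformed endpoint pair and the same bond cosine (`edge_reflBase`, `ccos_grad_reflBase`, …).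
These are exactly what the (R)/(P)/translation clauses of `QuasiLocalAction` ask of a bond action.
Folklore.
-/

noncomputable section

open scoped BigOperators Classical
open Finset

namespace Literature.Probability.LatticeModels.BalabanStepOne

variable {L' M : ℕ} [NeZero L'] [NeZero M]

/-- The endpoint pair of the bond `b = (s, i)`: `{s, s + eᵢ}`. [folklore] -/
def edge (b : Site L' M × Fin 3) : Finset (Site L' M) := {b.1, b.1 + dir L' M b.2}

/-- The complex gradient of `z` along the bond `b`. [folklore] -/
def grad (z : Site L' M → ℂ) (b : Site L' M × Fin 3) : ℂ := z (b.1 + dir L' M b.2) - z b.1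

omit [NeZero L'] [NeZero M] in
/-- Shifting one variable by `2π` does not change any complex bond cosine. [folklore] -/
theorem ccos_update_two_pi_sub (z : Site L' M → ℂ) (s₀ a c : Site L' M) :
    Complex.cos (Function.update z s₀ (z s₀ + 2 * Real.pi) a -
        Function.update z s₀ (z s₀ + 2 * Real.pi) c) = Complex.cos (z a - z c) := by
  by_cases ha : a = s₀ <;> by_cases hc : c = s₀
  · subst ha; subst hc; simp
  · subst ha
    rw [Function.update_self, Function.update_of_ne hc,
      show z a + 2 * Real.pi - z c = (z a - z c) + 2 * Real.pi by ring, Complex.cos_add_two_pi]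
  · subst hc
    rw [Function.update_self, Function.update_of_ne ha,
      show z a - (z c + 2 * Real.pi) = (z a - z c) - 2 * Real.pi by ring, Complex.cos_sub_two_pi]
  · rw [Function.update_of_ne ha, Function.update_of_ne hc]

omit [NeZero L'] [NeZero M] in
/-- `timeRefl` is an involution. [folklore] -/
@[simp] theorem timeRefl_timeRefl (s : Site L' M) : timeRefl (timeRefl s) = s := by
  simp [timeRefl]

omit [NeZero L'] [NeZero M] in
/-- `spaceInv` is an involution. [folklore] -/
@[simp] theorem spaceInv_spaceInv (s : Site L' M) : spaceInv (spaceInv s) = s := by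
  simp [spaceInv]

omit [NeZero L'] [NeZero M] in
/-- Time reflection reverses the temporal bond: `R (s + e_t) = R s - e_t`. [folklore] -/
theorem timeRefl_add_dir_two (s : Site L' M) : timeRefl (s + dir L' M 2) = timeRefl s - dir L' M 2 := by
  rw [dir_two, timeRefl_add_temporal, sub_eq_add_neg, Prod.neg_mk, neg_zero]

omit [NeZero L'] [NeZero M] in
/-- Time reflection commutes with the spatial bonds. [folklore] -/
theorem timeRefl_add_dir_of_ne_two (s : Site L' M) {i : Fin 3} (hi : i ≠ 2) :
    timeRefl (s + dir L' M i) = timeRefl s + dir L' M i := by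
  have h : i = 0 ∨ i = 1 := by
    fin_cases i
    · exact Or.inl rfl
    · exact Or.inr rfl
    · exact absurd rfl hi
  rcases h with rfl | rfl
  · rw [dir_zero, timeRefl_add_spatial]
  · rw [dir_one, timeRefl_add_spatial]

omit [NeZero L'] [NeZero M] in
/-- Space inversion reverses the spatial bonds. [folklore] -/
theorem spaceInv_add_dir_of_ne_two (s : Site L' M) {i : Fin 3} (hi : i ≠ 2) :
    spaceInv (s + dir L' M i) = spaceInv s - dir L' M i := by
  have h : i = 0 ∨ i = 1 := by
    fin_cases i
    · exact Or.inl rfl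
    · exact Or.inr rfl
    · exact absurd rfl hi
  rcases h with rfl | rfl
  · rw [dir_zero, spaceInv_add_spatial, sub_eq_add_neg, Prod.neg_mk, neg_zero]
  · rw [dir_one, spaceInv_add_spatial, sub_eq_add_neg, Prod.neg_mk, neg_zero]

omit [NeZero L'] [NeZero M] in
/-- Space inversion commutes with the temporal bond. [folklore] -/
theorem spaceInv_add_dir_two (s : Site L' M) : spaceInv (s + dir L' M 2) = spaceInv s + dir L' M 2 := by
  rw [dir_two, spaceInv_add_temporal]

/-- Base point of the time-reflected bond. [folklore] -/
def reflBase (s : Site L' M) (i : Fin 3) : Site L' M :=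
  if i = 2 then timeRefl s - dir L' M 2 else timeRefl s

/-- Base point of the space-inverted bond. [folklore] -/
def invBase (s : Site L' M) (i : Fin 3) : Site L' M :=
  if i = 2 then spaceInv s else spaceInv s - dir L' M i

omit [NeZero L'] [NeZero M] in
/-- `reflBase · i` is an involution. [folklore] -/
theorem reflBase_reflBase (s : Site L' M) (i : Fin 3) : reflBase (reflBase s i) i = s := by
  unfold reflBase
  by_cases hi : i = 2
  · subst hi
    rw [if_pos rfl, if_pos rfl, ← timeRefl_add_dir_two, sub_add_cancel, timeRefl_timeRefl]
  · rw [if_neg hi, if_neg hi, timeRefl_timeRefl]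

omit [NeZero L'] [NeZero M] in
/-- `invBase · i` is an involution. [folklore] -/
theorem invBase_invBase (s : Site L' M) (i : Fin 3) : invBase (invBase s i) i = s := by
  unfold invBase
  by_cases hi : i = 2
  · subst hi
    rw [if_pos rfl, if_pos rfl, spaceInv_spaceInv]
  · rw [if_neg hi, if_neg hi, ← spaceInv_add_dir_of_ne_two _ hi, sub_add_cancel, spaceInv_spaceInv]

omit [NeZero L'] [NeZero M] in
/-- The time-reflected bond has the reflected endpoint pair. [folklore] -/
theorem edge_reflBase (s : Site L' M) (i : Fin 3) :
    edge (reflBase s i, i) = (edge (s, i)).image timeRefl := by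
  unfold edge reflBase
  rw [Finset.image_insert, Finset.image_singleton]
  by_cases hi : i = 2
  · subst hi
    rw [if_pos rfl, sub_add_cancel, ← timeRefl_add_dir_two, Finset.pair_comm]
  · rw [if_neg hi, timeRefl_add_dir_of_ne_two _ hi]

omit [NeZero L'] [NeZero M] in
/-- The space-inverted bond has the inverted endpoint pair. [folklore] -/
theorem edge_invBase (s : Site L' M) (i : Fin 3) :
    edge (invBase s i, i) = (edge (s, i)).image spaceInv := by
  unfold edge invBase
  rw [Finset.image_insert, Finset.image_singleton]
  by_cases hi : i = 2
  · subst hi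
    rw [if_pos rfl, spaceInv_add_dir_two]
  · rw [if_neg hi, sub_add_cancel, ← spaceInv_add_dir_of_ne_two _ hi, Finset.pair_comm]

omit [NeZero L'] [NeZero M] in
/-- The bond cosine of the reflected configuration on the reflected bond. [folklore] -/
theorem ccos_grad_reflBase (z : Site L' M → ℂ) (s : Site L' M) (i : Fin 3) :
    Complex.cos (grad (fun x => z (timeRefl x)) (reflBase s i, i)) = Complex.cos (grad z (s, i)) := by
  unfold grad reflBase
  by_cases hi : i = 2
  · subst hi
    simp only [if_true]
    rw [sub_add_cancel, ← timeRefl_add_dir_two, timeRefl_timeRefl, timeRefl_timeRefl, ← Complex.cos_neg,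
      neg_sub]
  · simp only [if_neg hi]
    rw [← timeRefl_add_dir_of_ne_two _ hi, timeRefl_timeRefl, timeRefl_timeRefl]

omit [NeZero L'] [NeZero M] in
/-- The bond cosine of the inverted configuration on the inverted bond. [folklore] -/
theorem ccos_grad_invBase (z : Site L' M → ℂ) (s : Site L' M) (i : Fin 3) :
    Complex.cos (grad (fun x => z (spaceInv x)) (invBase s i, i)) = Complex.cos (grad z (s, i)) := by
  unfold grad invBase
  by_cases hi : i = 2
  · subst hi
    simp only [if_true]
    rw [← spaceInv_add_dir_two, spaceInv_spaceInv, spaceInv_spaceInv]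
  · simp only [if_neg hi]
    rw [sub_add_cancel, ← spaceInv_add_dir_of_ne_two _ hi, spaceInv_spaceInv, spaceInv_spaceInv,
      ← Complex.cos_neg, neg_sub]

omit [NeZero L'] [NeZero M] in
/-- `timeRefl` is injective. [folklore] -/
theorem timeRefl_injective : Function.Injective (timeRefl : Site L' M → Site L' M) :=
  Function.Involutive.injective timeRefl_timeRefl

omit [NeZero L'] [NeZero M] in
/-- `spaceInv` is injective. [folklore] -/
theorem spaceInv_injective : Function.Injective (spaceInv : Site L' M → Site L' M) :=
  Function.Involutive.injective spaceInv_spaceInv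

/-- Time reflection acting on bonds. [folklore] -/
def bondRefl : Site L' M × Fin 3 ≃ Site L' M × Fin 3 :=
  Function.Involutive.toPerm (fun b => (reflBase b.1 b.2, b.2)) fun b => by
    simp [reflBase_reflBase]

/-- Space inversion acting on bonds. [folklore] -/
def bondInv : Site L' M × Fin 3 ≃ Site L' M × Fin 3 :=
  Function.Involutive.toPerm (fun b => (invBase b.1 b.2, b.2)) fun b => by
    simp [invBase_invBase]

/-- Translation acting on bonds. [folklore] -/
def bondAdd (t : Site L' M) : Site L' M × Fin 3 ≃ Site L' M × Fin 3 :=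
  Equiv.prodCongr (Equiv.addRight t) (Equiv.refl _)

omit [NeZero L'] [NeZero M] in
/-- The translated bond has the translated endpoint pair. [folklore] -/
theorem edge_bondAdd (t : Site L' M) (b : Site L' M × Fin 3) :
    edge (bondAdd t b) = (edge b).image (· + t) := by
  simp only [edge, bondAdd, Equiv.prodCongr_apply, Equiv.coe_addRight, Prod.map_fst, Prod.map_snd,
    Equiv.coe_refl, id_eq, Finset.image_insert, Finset.image_singleton, add_right_comm _ t]

end Literature.Probability.LatticeModels.BalabanStepOne

end
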